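import Summits.HubbardSuperconductivity.HubbardSuperconductivity.Theorems.NodalDiracTwistTwistCalibrationBdGHolonomyLoop

/-!
# Route `NodalDiracTwist` — support `TwistCalibrationBdG`: the critical block along the loop (holonomy, part 5)

For stmt-HubbardSuperconductivity-1625, second clause: at the CRITICAL block (`cos q₀ = cos q₁ = cos κ`
at the centre `p`) the Nambu symbol along the loop satisfies the hypotheses of the winding mesh lemma
`exists_mesh_prod_neg` (`nodal_chart_hypotheses`): with `d = ε₁(1+ih)/|1+ih|` it meets `ℝ≥0·(-d)` only
at `θ ≡ 3π/2` and `ℝ≥0·d` only at `θ ≡ π/2` (so not on `[-π/3, 4π/3]`, resp. `[2π/3, 7π/3]`), and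
`Im(z conj d) = 4hε₁A/|1+ih|` has opposite strict signs near `θ = 0` and `θ = π` — the transversal
simple zero of `(A, B)` at the node (`exists_sign_cos_sub_cos`) makes the curve wind once.

Folklore. No definitions.
-/

-- the mandated namespace `Summit.<Summit>.<Problem>.Theorems` repeats `HubbardSuperconductivity`
-- (single-problem summit, D-0017), which the `dupNamespace` linter flags on every declaration
set_option linter.dupNamespace false

namespace Summit.HubbardSuperconductivity.HubbardSuperconductivity.Theorems.NodalDiracTwist

open Complex Set Literature.Probability.LatticeModels Literature.MathematicalPhysics.QuantumLattice
open scoped ComplexConjugate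

variable {L : ℕ} [NeZero L]

section Loop

variable {μ₀ h κ c r : ℝ} {p : Fin 2 → ℝ}

/-- `cos θ = 0` on `[2π/3, 7π/3]` forces `θ = 3π/2` (so `sin θ = -1`). [folklore] -/
theorem sin_eq_neg_one_of_cos_eq_zero_of_mem {θ : ℝ} (hθ : θ ∈ Set.Icc (2 * Real.pi / 3) (7 * Real.pi / 3))
    (hc : Real.cos θ = 0) : Real.sin θ = -1 := by
  have hpi := Real.pi_pos
  obtain ⟨m, hm⟩ := Real.cos_eq_zero_iff.mp hc
  have h1 : (2 * (m : ℝ) + 1) * Real.pi / 2 ≥ 2 * Real.pi / 3 := hm ▸ hθ.1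
  have h2 : (2 * (m : ℝ) + 1) * Real.pi / 2 ≤ 7 * Real.pi / 3 := hm ▸ hθ.2
  have h3 : (1 : ℝ) / 6 ≤ m := by nlinarith
  have h4 : (m : ℝ) ≤ 11 / 6 := by nlinarith
  have hm1 : m = 1 := by
    have h5 : (0 : ℤ) < m := by exact_mod_cast (by linarith : (0 : ℝ) < m)
    have h6 : m < (2 : ℤ) := by exact_mod_cast (by linarith : (m : ℝ) < 2)
    omega
  rw [hm, hm1]
  have : (2 * ((1 : ℤ) : ℝ) + 1) * Real.pi / 2 = Real.pi / 2 + Real.pi := by push_cast; ring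
  rw [this, Real.sin_add_pi, Real.sin_pi_div_two]

/-- `cos θ = 0` on `[-π/3, 4π/3]` forces `θ = π/2` (so `sin θ = 1`). [folklore] -/
theorem sin_eq_one_of_cos_eq_zero_of_mem {θ : ℝ} (hθ : θ ∈ Set.Icc (-(Real.pi / 3)) (4 * Real.pi / 3))
    (hc : Real.cos θ = 0) : Real.sin θ = 1 := by
  have hpi := Real.pi_pos
  obtain ⟨m, hm⟩ := Real.cos_eq_zero_iff.mp hc
  have h1 : (2 * (m : ℝ) + 1) * Real.pi / 2 ≥ -(Real.pi / 3) := hm ▸ hθ.1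
  have h2 : (2 * (m : ℝ) + 1) * Real.pi / 2 ≤ 4 * Real.pi / 3 := hm ▸ hθ.2
  have h3 : -(5 : ℝ) / 6 ≤ m := by nlinarith
  have h4 : (m : ℝ) ≤ 5 / 6 := by nlinarith
  have hm1 : m = 0 := by
    have h5 : (-1 : ℤ) < m := by exact_mod_cast (by linarith : (-1 : ℝ) < m)
    have h6 : m < (1 : ℤ) := by exact_mod_cast (by linarith : (m : ℝ) < 1)
    omega
  rw [hm, hm1]
  have : (2 * ((0 : ℤ) : ℝ) + 1) * Real.pi / 2 = Real.pi / 2 := by push_cast; ring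
  rw [this, Real.sin_pi_div_two]

/-- **The nodal block: chart hypotheses.** At the critical block (`cos q₀ = cos q₁ = cos κ` at the
centre) the Nambu symbol along the loop of radius `r` meets the cut rays `ℝ≥0·(±d)`,
`d = ε₁(1+ih)/|1+ih|`, only at `θ ≡ π/2, 3π/2` respectively, and near `θ = 0`, `θ = π` it lies in
opposite open half-planes bounded by the cut line — the hypotheses of the nodal mesh lemma. The signs
come from the transversal simple zero of `(A, B)` at the node. [folklore] -/
theorem nodal_chart_hypotheses (hh : h ≠ 0) (hκ : Real.cos κ = -μ₀ / 4) (hκ0 : 0 < κ) (hκπ : κ < Real.pi)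
    (hc0 : 0 < c) (hcπ : c < Real.pi) (hcos : Real.cos c = Real.cos (L * κ)) (hp0 : |p 0| = c)
    (hp1 : |p 1| = c) (hr0 : 0 < r) (hr : r < min c (Real.pi - c)) (k : TorusSite 2 L)
    (hq0 : Real.cos (latticeMomentum L k 0 + p 0 / L) = Real.cos κ)
    (hq1 : Real.cos (latticeMomentum L k 1 + p 1 / L) = Real.cos κ) :
    ∃ d : ℂ, ‖d‖ = 1 ∧ ∃ σ : ℝ, (σ = 1 ∨ σ = -1) ∧
      (∀ θ ∈ Set.Icc (-(Real.pi / 3)) (4 * Real.pi / 3),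
        ¬ ∃ t : ℝ, 0 ≤ t ∧ twistNambuZ L μ₀ h (
            (fun ν : Fin 2 => p ν + r * (if ν = 0 then Real.cos θ else Real.sin θ))) k = t * (-d)) ∧
      (∀ θ ∈ Set.Icc (2 * Real.pi / 3) (7 * Real.pi / 3),
        ¬ ∃ t : ℝ, 0 ≤ t ∧ twistNambuZ L μ₀ h (
            (fun ν : Fin 2 => p ν + r * (if ν = 0 then Real.cos θ else Real.sin θ))) k = t * d) ∧
      (∀ θ ∈ Set.Ioo (-(Real.pi / 3)) (Real.pi / 3),
        0 < σ * (twistNambuZ L μ₀ h (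
            (fun ν : Fin 2 => p ν + r * (if ν = 0 then Real.cos θ else Real.sin θ))) k * (starRingEnd ℂ) d).im) ∧
      (∀ θ ∈ Set.Ioo (2 * Real.pi / 3) (4 * Real.pi / 3),
        σ * (twistNambuZ L μ₀ h (
            (fun ν : Fin 2 => p ν + r * (if ν = 0 then Real.cos θ else Real.sin θ)))
            k * (starRingEnd ℂ) d).im < 0) := by
  have hpi := Real.pi_pos
  have hL0 : (0 : ℝ) < L := Nat.cast_pos.mpr (Nat.pos_of_ne_zero (NeZero.ne L))
  set ζ : ℂ := 1 + h * Complex.I with hζ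
  have hζ0 : ζ ≠ 0 := by intro h0; have := congrArg Complex.re h0; simp [hζ] at this
  have hζn : 0 < ‖ζ‖ := norm_pos_iff.mpr hζ0
  set A : ℝ → ℝ := fun θ => Real.cos (latticeMomentum L k 0 + p 0 / L + r * Real.cos θ / L) - Real.cos κ
    with hAdef
  set B : ℝ → ℝ := fun θ => Real.cos (latticeMomentum L k 1 + p 1 / L + r * Real.sin θ / L) - Real.cos κ
    with hBdef
  -- signs of the node functions
  obtain ⟨ε₀, hε₀, hAp, hAm⟩ := exists_sign_cos_sub_cos (L := L) (Q := latticeMomentum L k 0 + p 0 / L)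
    hκ0 hκπ hr0 hq0 (fun u hu hg => by
      refine eq_zero_of_cos_grid_eq (L := L) (k 0).val hc0 hcπ hcos hp0 hu hr ?_
      rw [sub_eq_zero] at hg
      rw [← hg, latticeMomentum]; congr 1; ring)
  obtain ⟨ε₁, hε₁, hBp, hBm⟩ := exists_sign_cos_sub_cos (L := L) (Q := latticeMomentum L k 1 + p 1 / L)
    hκ0 hκπ hr0 hq1 (fun u hu hg => by
      refine eq_zero_of_cos_grid_eq (L := L) (k 1).val hc0 hcπ hcos hp1 hu hr ?_
      rw [sub_eq_zero] at hg
      rw [← hg, latticeMomentum]; congr 1; ring)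
  -- translate to `A θ`, `B θ`
  have hAθ : ∀ θ, A θ = Real.cos (latticeMomentum L k 0 + p 0 / L + (r * Real.cos θ) / L) - Real.cos κ := by
    intro θ; rfl
  have hApos : ∀ θ, 0 < Real.cos θ → ε₀ * A θ < 0 := fun θ hθ =>
    hAp (r * Real.cos θ) ⟨mul_pos hr0 hθ, mul_le_of_le_one_right hr0.le (Real.cos_le_one θ)⟩
  have hAneg : ∀ θ, Real.cos θ < 0 → 0 < ε₀ * A θ := fun θ hθ =>
    hAm (r * Real.cos θ) ⟨by nlinarith [Real.neg_one_le_cos θ], mul_neg_of_pos_of_neg hr0 hθ⟩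
  have hBpos : ∀ θ, 0 < Real.sin θ → ε₁ * B θ < 0 := fun θ hθ =>
    hBp (r * Real.sin θ) ⟨mul_pos hr0 hθ, mul_le_of_le_one_right hr0.le (Real.sin_le_one θ)⟩
  have hBneg : ∀ θ, Real.sin θ < 0 → 0 < ε₁ * B θ := fun θ hθ =>
    hBm (r * Real.sin θ) ⟨by nlinarith [Real.neg_one_le_sin θ], mul_neg_of_pos_of_neg hr0 hθ⟩
  -- the direction
  set d : ℂ := (ε₁ : ℂ) * ζ / (‖ζ‖ : ℂ) with hd
  have hdn : ‖d‖ = 1 := by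
    rw [hd, norm_div, norm_mul, Complex.norm_real, Complex.norm_real, Real.norm_eq_abs, Real.norm_eq_abs,
      abs_of_pos hζn]
    rcases hε₁ with h1 | h1 <;> rw [h1] <;> simp [hζn.ne']
  -- on a ray `± d`: `A = 0` and the sign of `ε₁ B`
  have hray : ∀ θ (s : ℝ), (s = 1 ∨ s = -1) → ∀ t : ℝ, 0 ≤ t →
      twistNambuZ L μ₀ h (
          (fun ν : Fin 2 => p ν + r * (if ν = 0 then Real.cos θ else Real.sin θ))) k = t * ((s : ℂ) * d) →
      Real.cos θ = 0 ∧ s * (ε₁ * B θ) ≤ 0 := by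
    intro θ s hs t ht hz
    have hz' : twistNambuZ L μ₀ h (
        (fun ν : Fin 2 => p ν + r * (if ν = 0 then Real.cos θ else Real.sin θ)))
        k = (t : ℂ) * (((s * ε₁ : ℝ) : ℂ) * ζ / (‖ζ‖ : ℂ)) := by
      rw [hz, hd]; push_cast; ring
    have hA : A θ = 0 := nodeA_eq_zero_of_mem_line hh hκ k hz'
    refine ⟨cos_eq_zero_of_nodeA_eq_zero hc0 hcπ hcos hp0 hr0 hr k hA, ?_⟩
    rw [twistNambuZ_loopPt μ₀ h hκ] at hz'
    have hAz : ((Real.cos (latticeMomentum L k 0 + p 0 / L + r * Real.cos θ / L) - Real.cos κ : ℝ) : ℂ) = 0 := by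
      rw [show Real.cos (latticeMomentum L k 0 + p 0 / L + r * Real.cos θ / L) - Real.cos κ = A θ from rfl, hA,
        Complex.ofReal_zero]
    rw [hAz, mul_zero, zero_add] at hz'
    have h3 : (-2 * ((B θ : ℝ) : ℂ)) * ζ = ((t : ℂ) * ((s : ℂ) * (ε₁ : ℂ)) / (‖ζ‖ : ℂ)) * ζ := by
      calc (-2 * ((B θ : ℝ) : ℂ)) * ζ = -2 * ((1 + ↑h * Complex.I) *
            ↑(Real.cos (latticeMomentum L k 1 + p 1 / ↑L + r * Real.sin θ / ↑L) - Real.cos κ)) := by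
            rw [hζ]; simp only [hBdef]; ring
        _ = (t : ℂ) * (((s * ε₁ : ℝ) : ℂ) * ζ / (‖ζ‖ : ℂ)) := hz'
        _ = _ := by push_cast; ring
    have h4 := mul_right_cancel₀ hζ0 h3
    have h5 : -2 * B θ = t * (s * ε₁) / ‖ζ‖ := by exact_mod_cast h4
    have hss : s * s = 1 := by rcases hs with h1 | h1 <;> rw [h1] <;> norm_num
    have hee : ε₁ * ε₁ = 1 := by rcases hε₁ with h1 | h1 <;> rw [h1] <;> norm_num
    have : s * (ε₁ * B θ) = -(t / ‖ζ‖) / 2 := by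
      have : s * (ε₁ * (-2 * B θ)) = t / ‖ζ‖ := by
        rw [h5]
        have : s * (ε₁ * (t * (s * ε₁) / ‖ζ‖)) = (s * s) * (ε₁ * ε₁) * t / ‖ζ‖ := by ring
        rw [this, hss, hee]; ring
      linarith
    rw [this]
    have : 0 ≤ t / ‖ζ‖ := div_nonneg ht hζn.le
    linarith
  -- half-planes: `Im(z conj d) = 4 h ε₁ A / |ζ|`
  have him : ∀ θ, (twistNambuZ L μ₀ h (
      (fun ν : Fin 2 => p ν + r * (if ν = 0 then Real.cos θ else Real.sin θ)))
      k * (starRingEnd ℂ) d).im = 4 * h * ε₁ * A θ / ‖ζ‖ := by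
    intro θ
    rw [twistNambuZ_loopPt μ₀ h hκ, hd, hζ]
    simp only [map_mul, map_div₀, Complex.conj_ofReal, map_add, map_one, Complex.conj_I]
    rw [show Real.cos (latticeMomentum L k 0 + p 0 / L + r * Real.cos θ / L) - Real.cos κ = A θ from rfl,
      show Real.cos (latticeMomentum L k 1 + p 1 / L + r * Real.sin θ / L) - Real.cos κ = B θ from rfl]
    have hn : ((‖(1 : ℂ) + h * Complex.I‖ : ℝ) : ℂ) ≠ 0 := by
      rw [Ne, Complex.ofReal_eq_zero]; exact hζn.ne'
    field_simp
    simp [Complex.mul_re, Complex.mul_im, Complex.add_re, Complex.add_im]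
    ring
  set sg : ℝ := if 0 < h then 1 else -1 with hsg
  have hsgh : 0 < sg * h := by
    simp only [hsg]; split_ifs with h0
    · rwa [one_mul]
    · have : h < 0 := lt_of_le_of_ne (not_lt.mp h0) hh
      nlinarith
  refine ⟨d, hdn, -(ε₀ * ε₁ * sg), ?_, ?_, ?_, ?_, ?_⟩
  · rcases hε₀ with h0 | h0 <;> rcases hε₁ with h1 | h1 <;> simp only [hsg] <;> split_ifs <;>
      rw [h0, h1] <;> norm_num
  · -- the ray `-d` is met only where `cos θ = 0`, `ε₁ B > 0`, i.e. `sin θ < 0`; impossible on `K₁`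
    intro θ hθ ⟨t, ht, hz⟩
    have hz' : twistNambuZ L μ₀ h (
        (fun ν : Fin 2 => p ν + r * (if ν = 0 then Real.cos θ else Real.sin θ))) k = t * (((-1 : ℝ) : ℂ) * d) := by
      rw [hz]; push_cast; ring
    obtain ⟨hcθ, hsign⟩ := hray θ (-1) (Or.inr rfl) t ht hz'
    have hsθ := sin_eq_one_of_cos_eq_zero_of_mem hθ hcθ
    have := hBpos θ (by rw [hsθ]; exact one_pos)
    linarith
  · intro θ hθ ⟨t, ht, hz⟩
    have hz' : twistNambuZ L μ₀ h (
        (fun ν : Fin 2 => p ν + r * (if ν = 0 then Real.cos θ else Real.sin θ))) k = t * (((1 : ℝ) : ℂ) * d) := by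
      rw [hz]; push_cast; ring
    obtain ⟨hcθ, hsign⟩ := hray θ 1 (Or.inl rfl) t ht hz'
    have hsθ := sin_eq_neg_one_of_cos_eq_zero_of_mem hθ hcθ
    have := hBneg θ (by rw [hsθ]; norm_num)
    linarith
  · intro θ hθ
    have hcθ : 0 < Real.cos θ := Real.cos_pos_of_mem_Ioo ⟨by linarith [hθ.1], by linarith [hθ.2]⟩
    have hA := hApos θ hcθ
    rw [him]
    have hee : ε₁ * ε₁ = 1 := by rcases hε₁ with h1 | h1 <;> rw [h1] <;> norm_num
    have : -(ε₀ * ε₁ * sg) * (4 * h * ε₁ * A θ / ‖ζ‖) = -4 * ((sg * h) * (ε₀ * A θ)) * (ε₁ * ε₁) / ‖ζ‖ := by ring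
    rw [this, hee, mul_one]
    apply div_pos _ hζn
    nlinarith [mul_neg_of_pos_of_neg hsgh hA]
  · intro θ hθ
    have hcθ : Real.cos θ < 0 :=
      Real.cos_neg_of_pi_div_two_lt_of_lt (by linarith [hθ.1]) (by linarith [hθ.2])
    have hA := hAneg θ hcθ
    rw [him]
    have hee : ε₁ * ε₁ = 1 := by rcases hε₁ with h1 | h1 <;> rw [h1] <;> norm_num
    have : -(ε₀ * ε₁ * sg) * (4 * h * ε₁ * A θ / ‖ζ‖) = -4 * ((sg * h) * (ε₀ * A θ)) * (ε₁ * ε₁) / ‖ζ‖ := by ring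
    rw [this, hee, mul_one]
    apply div_neg_of_neg_of_pos _ hζn
    nlinarith [mul_pos hsgh hA]

end Loop

end Summit.HubbardSuperconductivity.HubbardSuperconductivity.Theorems.NodalDiracTwist
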